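import Literature.Probability.LatticeModels.StrongHarrisKleitman
import Literature.Probability.Percolation.PercolationEvents
import HarnessLib

/-!
# Gladkov's three-point strong Harris–Kleitman inequality (the Aas–Gladkov inequality)

Topic `Literature/Probability/Percolation`.  Bernoulli bond percolation with arbitrary edge
probabilities on a finite vertex type `V` (`μ = prodBernoulli w` on `BondConfig V = Set (Sym2 V)`) and
three vertices `a, b, c`.  Everything here is PROVED (no definition, no named fact): it is the printed
percolation corollary of Gladkov's strong Harris–Kleitman inequality (tree:
`Literature.Probability.LatticeModels.prodBernoulli_strongHarris`, Gladkov 2024 BLMS Thm. 2.1).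

## Source, as printed

N. Gladkov, *A strong FKG inequality for multiple events*, Bull. Lond. Math. Soc. 56 (2024),
doi:10.1112/blms.13101 = arXiv:2305.02653, §4.2 (read: `lit read arxiv:2305.02653`, p. 6):
"Consider a graph `G = (V, E)`, where `V = {1, 2, …, n}`. Consider the percolation on `G`, where each
edge `e ∈ E` has probability `p_e ∈ (0,1)` of surviving, independent of other edges. … Consider three
vertices `1, 2, 3 ∈ V`. Denote by `P(123)` the probability that vertices `1`, `2` and `3` lie in the same
connected component of `H`. Denote by `P(12|3)` the probability that `1` and `2` lie in the same
connected component, different from the component of `3`. Define `P(13|2)` and `P(1|23)` analogously.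
Finally, denote by `P(1|2|3)` the probability that all three vertices lie in different connected
components.
**Corollary 4.2.** In the notation above, we have:
`P(123) P(1|2|3) ≥ P(12|3) P(13|2) + P(12|3) P(1|23) + P(13|2) P(1|23)`.
*Proof.* Note that events `A = (123)`, `B = (1|2|3)`, `C_1 = (1|23)`, `C_2 = (13|2)`, `C_3 = (12|3)`
satisfy the conditions of Theorem 2.1. The inequality follows."
Gladkov–Zimin, *Bond percolation does not simulate site percolation*, arXiv:2404.08873, §5: "it also
proves inequality `P(abc)P(a|b|c) ≥ P(ab|c)P(ac|b) + P(ab|c)P(a|bc) + P(ac|b)P(a|bc)`, which was first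
conjectured in an unpublished work of Erik Aas and proved in [G]. It is stronger than what
Harris–Kleitman inequality can tell about these events."

## What is proved

* `prodBernoulli_threePoint_strongHarris` — Corollary 4.2 for `μ = prodBernoulli w`, arbitrary weights
  `w : Sym2 V → [0,1]` (edges of weight `0`/`1` allowed: the tree's Thm. 2.1 is stated for all of
  `[0,1]`), with `{x ↔ y} = openConn x y` and the five cells written as intersections:
  `μ(ab|c) μ(ac|b) + μ(ab|c) μ(a|bc) + μ(ac|b) μ(a|bc) ≤ μ(abc) μ(a|b|c)`.
  Proof = the printed one: the cells `C_1 = a|bc`, `C_2 = ac|b`, `C_3 = ab|c` are pairwise disjoint,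
  disjoint from `A = abc`, and `A ∪ C_1 = {b ↔ c}`, `A ∪ C_2 = {a ↔ c}`, `A ∪ C_3 = {a ↔ b}` are
  increasing; the complement of `A ∪ C_1 ∪ C_2 ∪ C_3` is `a|b|c`; apply `prodBernoulli_strongHarris`
  with the index set `Fin 3` and halve.

* `prodBernoulli_threePoint_strongHarris_term` — one product of the left side against the right side
  (`μ(ab|c) μ(ac|b) ≤ μ(abc) μ(a|b|c)`), the form in which the inequality is used for three-terminal
  petal-mass ("diamond") bounds.

Consumer: the hull-port exchange line of crux stmt-CriticalPhenomena-4575 (`NoHeavyLowerTail`): on the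
15 port patterns of a three-port hull region this is the first valid "interior row" beyond two-cluster
association (memo run/shared/lean/prim/prim-lit-3/T3CERT-RESULTS.md §2).

## References

* N. Gladkov, *A strong FKG inequality for multiple events*, Bull. Lond. Math. Soc. 56 (2024),
  doi:10.1112/blms.13101, arXiv:2305.02653: Thm. 2.1 (§2), Cor. 4.2 (§4.2). [Gladkov2024StrongFKG]
* N. Gladkov, A. Zimin, *Bond percolation does not simulate site percolation*, arXiv:2404.08873,
  Electron. Commun. Probab. (2026), §5 (attribution to E. Aas). [GladkovZimin2024]
-/

noncomputable section

namespace Literature.Probability.Percolation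

open MeasureTheory Literature.Probability.LatticeModels

variable {V : Type*} [Finite V]

omit [Finite V] in
/-- Transitivity of `↔`. [folklore] -/
private theorem openConn_trans' {x y z : V} {ω : BondConfig V} (h₁ : ω ∈ openConn x y)
    (h₂ : ω ∈ openConn y z) : ω ∈ openConn x z :=
  SimpleGraph.Reachable.trans h₁ h₂

omit [Finite V] in
/-- Symmetry of `↔`. [folklore] -/
private theorem openConn_symm' {x y : V} {ω : BondConfig V} (h : ω ∈ openConn x y) :
    ω ∈ openConn y x :=
  SimpleGraph.Reachable.symm h

/-- **Gladkov 2024 (BLMS), Corollary 4.2 — the three-point strong Harris–Kleitman (Aas–Gladkov)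
inequality.**  For Bernoulli bond percolation `μ = prodBernoulli w` with arbitrary edge weights on a
finite vertex type and three vertices `a, b, c`, writing `abc = {a↔b} ∩ {a↔c}`,
`ab|c = {a↔b} ∩ {a↔c}ᶜ`, `ac|b = {a↔c} ∩ {a↔b}ᶜ`, `a|bc = {b↔c} ∩ {a↔b}ᶜ`,
`a|b|c = {a↔b}ᶜ ∩ {a↔c}ᶜ ∩ {b↔c}ᶜ`:
`μ(ab|c) μ(ac|b) + μ(ab|c) μ(a|bc) + μ(ac|b) μ(a|bc) ≤ μ(abc) μ(a|b|c)`.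
[cite: Gladkov2024StrongFKG, Cor. 4.2 (and Thm. 2.1)] -/
theorem prodBernoulli_threePoint_strongHarris (w : Sym2 V → unitInterval) (a b c : V) :
    (prodBernoulli w).real (openConn a b ∩ (openConn a c)ᶜ) *
          (prodBernoulli w).real (openConn a c ∩ (openConn a b)ᶜ) +
        (prodBernoulli w).real (openConn a b ∩ (openConn a c)ᶜ) *
          (prodBernoulli w).real (openConn b c ∩ (openConn a b)ᶜ) +
        (prodBernoulli w).real (openConn a c ∩ (openConn a b)ᶜ) *
          (prodBernoulli w).real (openConn b c ∩ (openConn a b)ᶜ) ≤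
      (prodBernoulli w).real (openConn a b ∩ openConn a c) *
        (prodBernoulli w).real ((openConn a b)ᶜ ∩ (openConn a c)ᶜ ∩ (openConn b c)ᶜ) := by
  classical
  -- the cells of Gladkov's theorem: `A = abc`, `C₀ = a|bc`, `C₁ = ac|b`, `C₂ = ab|c`
  set A : Set (BondConfig V) := openConn a b ∩ openConn a c with hA
  set C₀ : Set (BondConfig V) := openConn b c ∩ (openConn a b)ᶜ with hC₀
  set C₁ : Set (BondConfig V) := openConn a c ∩ (openConn a b)ᶜ with hC₁
  set C₂ : Set (BondConfig V) := openConn a b ∩ (openConn a c)ᶜ with hC₂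
  -- pairwise disjointness
  have d01 : Disjoint C₀ C₁ :=
    Set.disjoint_left.2 fun ω h0 h1 => h0.2 (openConn_trans' h1.1 (openConn_symm' h0.1))
  have d02 : Disjoint C₀ C₂ := Set.disjoint_left.2 fun ω h0 h2 => h0.2 h2.1
  have d12 : Disjoint C₁ C₂ := Set.disjoint_left.2 fun ω h1 h2 => h1.2 h2.1
  have dA0 : Disjoint A C₀ := Set.disjoint_left.2 fun ω hA' h0 => h0.2 hA'.1
  have dA1 : Disjoint A C₁ := Set.disjoint_left.2 fun ω hA' h1 => h1.2 hA'.1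
  have dA2 : Disjoint A C₂ := Set.disjoint_left.2 fun ω hA' h2 => h2.2 hA'.2
  -- `A ∪ Cᵢ` are connection events
  have hU0 : A ∪ C₀ = openConn b c := by
    ext ω
    constructor
    · rintro (hA' | h0)
      · exact openConn_trans' (openConn_symm' hA'.1) hA'.2
      · exact h0.1
    · intro hbc
      by_cases hab : ω ∈ openConn a b
      · exact Or.inl ⟨hab, openConn_trans' hab hbc⟩
      · exact Or.inr ⟨hbc, hab⟩
  have hU1 : A ∪ C₁ = openConn a c := by
    ext ω
    constructor
    · rintro (hA' | h1)
      · exact hA'.2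
      · exact h1.1
    · intro hac
      by_cases hab : ω ∈ openConn a b
      · exact Or.inl ⟨hab, hac⟩
      · exact Or.inr ⟨hac, hab⟩
  have hU2 : A ∪ C₂ = openConn a b := by
    ext ω
    constructor
    · rintro (hA' | h2)
      · exact hA'.1
      · exact h2.1
    · intro hab
      by_cases hac : ω ∈ openConn a c
      · exact Or.inl ⟨hab, hac⟩
      · exact Or.inr ⟨hab, hac⟩
  have up0 : IsUpperSet (A ∪ C₀) := by rw [hU0]; exact isUpperSet_openConn b c
  have up1 : IsUpperSet (A ∪ C₁) := by rw [hU1]; exact isUpperSet_openConn a c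
  have up2 : IsUpperSet (A ∪ C₂) := by rw [hU2]; exact isUpperSet_openConn a b
  have hAup : IsUpperSet A := (isUpperSet_openConn a b).inter (isUpperSet_openConn a c)
  -- index the cells by `Fin 3`
  let C : Fin 3 → Set (BondConfig V) := ![C₀, C₁, C₂]
  have e0 : C 0 = C₀ := rfl
  have e1 : C 1 = C₁ := rfl
  have e2 : C 2 = C₂ := rfl
  have hdisj : ∀ i ∈ (Finset.univ : Finset (Fin 3)), ∀ j ∈ (Finset.univ : Finset (Fin 3)),
      i ≠ j → Disjoint (C i) (C j) := by
    intro i _ j _ hij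
    fin_cases i <;> fin_cases j
    all_goals first
      | exact (hij rfl).elim
      | exact d01 | exact d01.symm | exact d02 | exact d02.symm | exact d12 | exact d12.symm
  have hdisjA : ∀ i ∈ (Finset.univ : Finset (Fin 3)), Disjoint A (C i) := by
    intro i _
    fin_cases i
    · exact dA0
    · exact dA1
    · exact dA2
  have hup : ∀ i ∈ (Finset.univ : Finset (Fin 3)), IsUpperSet (A ∪ C i) := by
    intro i _
    fin_cases i
    · exact up0
    · exact up1
    · exact up2
  have key := prodBernoulli_strongHarris w (Finset.univ : Finset (Fin 3)) hdisj hdisjA hup hAup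
  -- identify the bottom cell
  have hB : (A ∪ ⋃ i ∈ (Finset.univ : Finset (Fin 3)), C i)ᶜ =
      (openConn a b)ᶜ ∩ (openConn a c)ᶜ ∩ (openConn b c)ᶜ := by
    have h3 : (⋃ i ∈ (Finset.univ : Finset (Fin 3)), C i) = C₀ ∪ C₁ ∪ C₂ := by
      ext ω
      simp only [Finset.mem_univ, Set.iUnion_true, Set.mem_iUnion, Set.mem_union]
      constructor
      · rintro ⟨i, hi⟩
        fin_cases i
        · exact Or.inl (Or.inl hi)
        · exact Or.inl (Or.inr hi)
        · exact Or.inr hi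
      · rintro ((h | h) | h)
        · exact ⟨0, h⟩
        · exact ⟨1, h⟩
        · exact ⟨2, h⟩
    have hunion : A ∪ (C₀ ∪ C₁ ∪ C₂) = openConn a b ∪ openConn a c ∪ openConn b c := by
      rw [← hU0, ← hU1, ← hU2]
      ext ω; simp only [Set.mem_union]; tauto
    rw [h3, hunion]
    ext ω
    simp only [Set.mem_compl_iff, Set.mem_union, not_or, Set.mem_inter_iff]
  rw [hB] at key
  -- expand the `Fin 3` sums and halve
  simp only [Fin.sum_univ_three, e0, e1, e2] at key
  nlinarith [key]

/-- **One term of Corollary 4.2** (the single-product form used for three-terminal "diamond" bounds): each of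
the three products on the left of Gladkov's inequality is bounded by its right side; here the first one,
`μ(ab|c) μ(ac|b) ≤ μ(abc) μ(a|b|c)`, i.e. seen from the apex `a`:
`P(a↔b, a↮c) · P(a↔c, a↮b) ≤ P(a↔b, a↔c) · P(a, b, c pairwise disconnected)`.  Immediate from
`prodBernoulli_threePoint_strongHarris` by dropping the two other (nonnegative) products; with
`(a, b, c) ↦ (c, a, b)` it is the inequality `u_a u_b ≤ q t` between the petal masses of the three-point
connectivity pattern law.  (The other two single products follow by the same one-line argument, or by
symmetry in `b, c`.) [cite: Gladkov2024StrongFKG, Cor. 4.2 (one term of the left side)] -/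
theorem prodBernoulli_threePoint_strongHarris_term (w : Sym2 V → unitInterval) (a b c : V) :
    (prodBernoulli w).real (openConn a b ∩ (openConn a c)ᶜ) *
        (prodBernoulli w).real (openConn a c ∩ (openConn a b)ᶜ) ≤
      (prodBernoulli w).real (openConn a b ∩ openConn a c) *
        (prodBernoulli w).real ((openConn a b)ᶜ ∩ (openConn a c)ᶜ ∩ (openConn b c)ᶜ) := by
  have h := prodBernoulli_threePoint_strongHarris w a b c
  have h0 : 0 ≤ (prodBernoulli w).real (openConn a b ∩ (openConn a c)ᶜ) *
      (prodBernoulli w).real (openConn b c ∩ (openConn a b)ᶜ) :=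
    mul_nonneg measureReal_nonneg measureReal_nonneg
  have h1 : 0 ≤ (prodBernoulli w).real (openConn a c ∩ (openConn a b)ᶜ) *
      (prodBernoulli w).real (openConn b c ∩ (openConn a b)ᶜ) :=
    mul_nonneg measureReal_nonneg measureReal_nonneg
  linarith

end Literature.Probability.Percolation
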